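import Literature.IUT.HodgeTheaters.StableCurveTemperedDataOfSpecialFibre
import Literature.IUT.HodgeTheaters.ProfiniteCompletionRestrictOpen
import Literature.IUT.HodgeTheaters.TemperedCoveringsProp24SubProofs
import Literature.AnabelianGeometry.SemiGraphs.TemperedSpecialFibreTower
import HarnessLib

/-!
# [IUTchI] Prop. 2.4 (i): the LEVEL DATA `Prop24Tower` at the genuine 𝔛-data, from the special-fibre tower
# of [SemiAnbd] Example 3.10

Mochizuki, *Inter-universal Teichmüller theory I*, kurims manuscript (May 2020), §2, proof of Prop. 2.4 (i),
p. 50 l. 27–33: "finite index characteristic open subgroups `J ⊆ Δ^tp_X` … the closure `Ĵ` of `J` in `Π̂_X`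
… `Ĵ ∩ Δ^tp_X = J` … the pro-`Σ` semi-graph of anabelioids `𝔾_J` associated to the special fiber of the stable
model … of the covering determined by `J` … `J ↠ Π^tp_{𝔾_J}` … the natural surjection on pro-`Σ̂` completions
`Ĵ ↠ Π̂_{𝔾_J}`" [cite: Mochizuki2012, Prop 2.4(i) p.50] (D-0012 claim key; nothing of the series is asserted
here), over Mochizuki, *Semi-graphs of anabelioids*, Publ. RIMS **42** (2006), Example 3.10 pp. 44–45
[cite: MochizukiSemiAnbd2006, Ex 3.10 pp.44-45].

BRIDGE (abc-iut L3 → L5, continuation of `StableCurveTemperedDataOfSpecialFibre.lean`; prover abc-iut-L5-t11).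
abc-iut-w5-d119's LEVEL DATA `StableCurveTemperedData.Prop24Tower` (`TemperedCoveringsProp24Sub.lean`: levels
`Ĵ_i ⊆ Π̂_X`, graphs `𝔾_{J_i}`, `J_i ↠ Π^tp_{𝔾_{J_i}}`, `Ĵ_i ↠ Π̂_{𝔾_{J_i}}`, compatibly) is CONSTRUCTED for
the genuine 𝔛-data `ofSpecialFibre X d S …` from L3's special-fibre tower
`T : SpecialFibreTower Δ^temp_X` ([SemiAnbd] Ex. 3.10, abc-iut-L3: "an exhaustive sequence of open
characteristic subgroups of finite index `N_i`", the special fibres `𝒢^c_i` with charts, the admissible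
quotients `adm i : N_i ↠ π₁^temp(𝒢_i)`):
* `Ĵ_i :=` the closure of `ι(N_i)` in `Δ_X ⊆ Π_{X_K}` — so "`Ĵ ∩ Δ^tp_X = J`" is the THEOREM
  `IsProfiniteCompletion.comap_topologicalClosure_map` for the completion `Δ^temp_X → Δ_X` (abc-iut-w5-d139);
* `𝔾_{J_i} := TemperedGraphGroupData.ofChart (𝒢^c_i)` (`Π^tp := π₁^temp(𝒢_i)`, `Π̂ :=` its profinite completion;
  the sub-semi-graph `ℍ` is irrelevant for Prop. 2.4 and is set to the whole graph, `Π_ℍ := ⊤`);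
* `J_i ↠ Π^tp_{𝔾_{J_i}} := adm i`; `Ĵ_i ↠ Π̂_{𝔾_{J_i}} :=` the profinite EXTENSION of `adm i` along
  `N_i → Ĵ_i`, which is a profinite completion (`ProfiniteCompletionRestrict.isProfiniteCompletion_restrict`).
The structural sub-nodes of abc-iut-w5-d119's sub-DAG are then THEOREMS at the genuine datum: `LevelsClosed`,
`LevelsInDelta`, `LevelsNormal`, `LevelsOpen` (below), `DeltaHatClosed`, `DeltaHatDense`; `LevelsCofinal`
holds under the COFINALITY reading of "exhaustive" (hypothesis `hcof`: every open normal finite-index subgroup of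
`Δ^temp_X` contains some `N_i` — L3's field `N_exhaustive : ⋂ N_i = 1` is weaker and does not imply it).
Capstone `prop24i_ofSpecialFibre_of_tower`: Prop. 2.4 (i) AS TYPED at the genuine datum ⇐ the named analytic
inputs of the sub-DAG ONLY — Prop. 2.1 at every level (`Prop21Levels`), "[Config] Rmk 1.2.2"
(`StronglyTorsionFreeSigma`), the `p ∉ Σ` specialisation half (`SpecializationAb`), the inverse-limit
statement (`DetectsTempered`) — and `hcof`.  Model-relative (∀ `X`, `d`, `S`, `T`); typed ≠ discharged for
those inputs; nothing here bears on [IUTchIII] Cor. 3.12.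
-/

noncomputable section

namespace Literature.IUT.HodgeTheaters

open Topology
open Literature.AnabelianGeometry.SemiGraphs Literature.AnabelianGeometry.SemiGraphs.ProfiniteSemiGraph

namespace StableCurveTemperedData

namespace OfSpecialFibre

variable {p : ℕ} [Fact p.Prime] (X : TemperedCurve p) (d : X.GroupLevelData)
  (T : SpecialFibreTower X.DeltaTemp)

/-! ### The levels `Ĵ_i` -/

/-- `Ĵ_i ∩ Δ̂_X`, read in `Δ_X`: the closure of `ι(N_i)` in `Δ_X`. ([IUTchI] Prop 2.4(i) p.50) [claim: Mochizuki2012, status: disputed] -/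
def levelHat (i : ℕ) : Subgroup X.DeltaHat := ((T.N i).map X.deltaToHat.toMonoidHom).topologicalClosure

/-- `Ĵ_i ⊆ Π̂_X`: the closure of `ι(N_i)` in `Δ_X`, read in `Π_{X_K}`. ([IUTchI] Prop 2.4(i) p.50) [claim: Mochizuki2012, status: disputed] -/
def levelJhat (i : ℕ) : Subgroup X.PiHat := (levelHat X T i).map X.DeltaHat.subtype

/-- Membership in `Ĵ_i`. ([IUTchI] Prop 2.4(i) p.50) [claim: Mochizuki2012, status: disputed] -/
theorem mem_levelJhat_iff {i : ℕ} {z : X.PiHat} :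
    z ∈ levelJhat X T i ↔ ∃ hz : z ∈ X.DeltaHat, (⟨z, hz⟩ : X.DeltaHat) ∈ levelHat X T i := by
  constructor
  · rintro ⟨y, hy, rfl⟩
    exact ⟨y.2, hy⟩
  · rintro ⟨hz, h⟩
    exact ⟨⟨z, hz⟩, h, rfl⟩

/-- `Ĵ_i ⊆ Δ_X`. ([IUTchI] Prop 2.4(i) p.50) [claim: Mochizuki2012, status: disputed] -/
theorem levelJhat_le_deltaHat (i : ℕ) : levelJhat X T i ≤ X.DeltaHat := by
  rintro _ ⟨y, _, rfl⟩
  exact y.2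

/-- `(Ĵ_i)` read back in `Δ_X` is `levelHat`. ([IUTchI] Prop 2.4(i) p.50) [claim: Mochizuki2012, status: disputed] -/
theorem levelJhat_subgroupOf (i : ℕ) : (levelJhat X T i).subgroupOf X.DeltaHat = levelHat X T i := by
  rw [← Subgroup.comap_subtype, levelJhat, Subgroup.comap_map_eq_self_of_injective Subtype.val_injective]

include d in
/-- **"`Ĵ ∩ Δ^tp_X = J`"** (p. 50 l. 33): `ι⁻¹(Ĵ_i) ∩ Δ^temp_X = N_i` — the completion axiom for
`Δ^temp_X → Δ_X` (`isProfiniteCompletion_deltaToHat`, abc-iut-w5-d139) applied to the open finite-index `N_i`.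
([IUTchI] Prop 2.4(i) p.50) [claim: Mochizuki2012, status: disputed] -/
theorem comap_levelHat (i : ℕ) : (levelHat X T i).comap X.deltaToHat.toMonoidHom = T.N i := by
  haveI := T.N_finiteIndex i
  exact (X.isProfiniteCompletion_deltaToHat d).comap_topologicalClosure_map (T.N i) (T.isOpen_N i)

include d in
/-- Membership form of "`Ĵ ∩ Δ^tp_X = J`": for `x ∈ Δ^temp_X`, `ι(x) ∈ Ĵ_i ↔ x ∈ N_i`.
([IUTchI] Prop 2.4(i) p.50) [claim: Mochizuki2012, status: disputed] -/
theorem toHat_mem_levelJhat_iff (i : ℕ) (x : X.DeltaTemp) :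
    X.toHat (x : X.PiTemp) ∈ levelJhat X T i ↔ x ∈ T.N i := by
  rw [← comap_levelHat X d T i, Subgroup.mem_comap, mem_levelJhat_iff]
  constructor
  · rintro ⟨_, h⟩
    exact h
  · intro h
    exact ⟨(X.deltaToHat x).2, h⟩

/-- `Ĵ_i` is closed in `Π̂_X` (it is the image of a closed subgroup of the closed `Δ_X`).
([IUTchI] Prop 2.4(i) p.50) [claim: Mochizuki2012, status: disputed] -/
theorem isClosed_levelJhat (i : ℕ) : IsClosed ((levelJhat X T i : Subgroup X.PiHat) : Set X.PiHat) := by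
  have hΔ : IsClosed (X.DeltaHat : Set X.PiHat) := Subgroup.isClosed_topologicalClosure _
  have h' : IsClosed ((levelHat X T i : Subgroup X.DeltaHat) : Set X.DeltaHat) :=
    Subgroup.isClosed_topologicalClosure _
  rw [levelJhat, Subgroup.coe_map]
  exact hΔ.isClosedEmbedding_subtypeVal.isClosedMap _ h'

include d in
/-- `Ĵ_i ∩ Δ_X` is open in `Δ_X` (`N_i` is open of finite index).
([IUTchI] Prop 2.4(i) p.50) [claim: Mochizuki2012, status: disputed] -/
theorem isOpen_levelHat (i : ℕ) : IsOpen ((levelHat X T i : Subgroup X.DeltaHat) : Set X.DeltaHat) := by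
  haveI := T.N_finiteIndex i
  exact (X.isProfiniteCompletion_deltaToHat d).isOpen_topologicalClosure_map (T.N i) (T.isOpen_N i)

/-- `Ĵ_i ∩ Δ_X` is normal in `Δ_X` (`N_i ⊴ Δ^temp_X`, the image of `Δ^temp_X` is dense, the closure is
closed). ([IUTchI] Prop 2.4(i) p.50) [claim: Mochizuki2012, status: disputed] -/
theorem levelHat_normal (i : ℕ) : (levelHat X T i).Normal := by
  haveI := T.N_normal i
  refine ProfiniteCompletionRestrict.normal_of_dense_conj _ (Subgroup.isClosed_topologicalClosure _)
    (X.denseRange_deltaToHat) ?_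
  rintro _ ⟨m, rfl⟩ h hh
  refine ProfiniteCompletionRestrict.conj_mem_topologicalClosure_of_forall _ _ (fun k hk => ?_) h hh
  obtain ⟨n, hn, rfl⟩ := hk
  refine ⟨m * n * m⁻¹, (T.N_normal i).conj_mem n hn m, ?_⟩
  simp only [map_mul, map_inv]
  rfl

/-! ### The maps `J_i ↠ Π^tp_{𝔾_{J_i}}` and `Ĵ_i ↠ Π̂_{𝔾_{J_i}}` -/

/-- The completion map `N_i → Ĵ_i ∩ Δ_X` (restriction of `Δ^temp_X → Δ_X`).
([IUTchI] Prop 2.4(i) p.50) [claim: Mochizuki2012, status: disputed] -/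
def iotaLevel (i : ℕ) : T.N i →ₜ* levelHat X T i where
  toFun n := ⟨X.deltaToHat (n : X.DeltaTemp),
    Subgroup.le_topologicalClosure _ ⟨(n : X.DeltaTemp), n.2, rfl⟩⟩
  map_one' := Subtype.ext (by simp)
  map_mul' a b := Subtype.ext (by simp)
  continuous_toFun := (X.deltaToHat.continuous.comp continuous_subtype_val).subtype_mk _

include d in
/-- **`Ĵ_i ∩ Δ_X` is the profinite completion of `N_i`** (restriction of a profinite completion to an open
subgroup of finite index). ([IUTchI] Prop 2.4(i) p.50) [claim: Mochizuki2012, status: disputed] -/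
theorem iotaLevel_isProfiniteCompletion (i : ℕ) : IsProfiniteCompletion (iotaLevel X T i) := by
  haveI := T.N_finiteIndex i
  exact ProfiniteCompletionRestrict.isProfiniteCompletion_restrict (X.isProfiniteCompletion_deltaToHat d)
    (T.N i) (T.isOpen_N i) (levelHat X T i) rfl (iotaLevel X T i) (fun _ => rfl)

variable (Sigma SigmaHat : Set ℕ) (hsub : Sigma ⊆ SigmaHat) (hne : Sigma.Nonempty)
  (hprime : ∀ q ∈ SigmaHat, q.Prime)

/-- The level graph data `𝔾_{J_i} := ofChart (𝒢^c_i)` (`Π^tp := π₁^temp(𝒢_i)` in the tower's chart, `Π̂ :=`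
its profinite completion; `ℍ := 𝔾_{J_i}`). ([IUTchI] Prop 2.4(i) p.50) [claim: Mochizuki2012, status: disputed] -/
def levelGraph (i : ℕ) : TemperedGraphGroupData.{0} :=
  TemperedGraphGroupData.ofChart (T.Gc i) (T.hyp i).toProp36Hypotheses (T.chart i) Sigma SigmaHat hsub hne
    hprime ⊤ ⊤ le_top

/-- The completion map `π₁^temp(𝒢_i) → Π̂_{𝔾_{J_i}}` of the level graph, as a continuous homomorphism.
([IUTchI] Prop 2.4(i) p.50) [claim: Mochizuki2012, status: disputed] -/
def iotaGraph (i : ℕ) :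
    (T.chart i).G →ₜ* (TemperedGraphGroupData.exists_completion_of_prop36 (T.Gc i)
      (T.hyp i).toProp36Hypotheses (T.chart i)).choose :=
  (TemperedGraphGroupData.exists_completion_of_prop36 (T.Gc i) (T.hyp i).toProp36Hypotheses
    (T.chart i)).choose_spec.choose

include d in
/-- Existence of the extension `Ĵ_i ∩ Δ_X → Π̂_{𝔾_{J_i}}` of `N_i ↠ π₁^temp(𝒢_i) ↪ Π̂_{𝔾_{J_i}}`.
([IUTchI] Prop 2.4(i) p.50) [claim: Mochizuki2012, status: disputed] -/
theorem exists_piHatLevel (i : ℕ) :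
    ∃ Φ : levelHat X T i →ₜ* (TemperedGraphGroupData.exists_completion_of_prop36 (T.Gc i)
      (T.hyp i).toProp36Hypotheses (T.chart i)).choose,
      ∀ n : T.N i, Φ (iotaLevel X T i n) = iotaGraph X T i (T.adm i n) :=
  (iotaLevel_isProfiniteCompletion X d T i).exists_extension
    ((iotaGraph X T i).comp (T.adm i))

include d in
/-- `Ĵ_i ∩ Δ_X ↠ Π̂_{𝔾_{J_i}}`: "the natural surjection on pro-`Σ̂` completions" (p. 50 l. 33), the
profinite extension of `adm i`. ([IUTchI] Prop 2.4(i) p.50) [claim: Mochizuki2012, status: disputed] -/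
def piHatLevel (i : ℕ) :
    levelHat X T i →ₜ* (TemperedGraphGroupData.exists_completion_of_prop36 (T.Gc i)
      (T.hyp i).toProp36Hypotheses (T.chart i)).choose :=
  (exists_piHatLevel X d T i).choose

/-- The defining property of `piHatLevel`. ([IUTchI] Prop 2.4(i) p.50) [claim: Mochizuki2012, status: disputed] -/
theorem piHatLevel_iotaLevel (i : ℕ) (n : T.N i) :
    piHatLevel X d T i (iotaLevel X T i n) =
      iotaGraph X T i (T.adm i n) :=
  (exists_piHatLevel X d T i).choose_spec n

variable (S : SpecialFibreData (X.toTemperedArithmeticGroup d)) (h36 : S.Gc.Prop36Hypotheses)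
  (hp : p ∉ Sigma) (TpH : Subgroup S.chart.G)
  (HatH : Subgroup (TemperedGraphGroupData.exists_completion_of_prop36 S.Gc h36 S.chart).choose)
  (hle : TpH.map (TemperedGraphGroupData.exists_completion_of_prop36 S.Gc h36
    S.chart).choose_spec.choose.toMonoidHom ≤ HatH)
  (cuspMeetsH : {x : X.Pt // X.IsCusp x} → Prop)

/-- The level `J_i = Δ^tp_X ∩ ι⁻¹(Ĵ_i)` of the genuine datum IS `N_i` (same underlying elements of
`Π^temp_{X_K}`): the identification homomorphism. ([IUTchI] Prop 2.4(i) p.50) [claim: Mochizuki2012, status: disputed] -/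
def levelToN (i : ℕ) :
    (ofSpecialFibre X d S h36 Sigma SigmaHat hsub hne hprime hp TpH HatH hle cuspMeetsH).levelTp
        (levelJhat X T i) →* T.N i where
  toFun x := ⟨⟨(x.1 : X.PiTemp), (ker_augGK_eq_deltaTemp X) ▸ x.1.2⟩,
    (toHat_mem_levelJhat_iff X d T i _).1 x.2⟩
  map_one' := Subtype.ext (Subtype.ext rfl)
  map_mul' _ _ := Subtype.ext (Subtype.ext rfl)

/-- `levelToN` is continuous and surjective. ([IUTchI] Prop 2.4(i) p.50) [claim: Mochizuki2012, status: disputed] -/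
theorem levelToN_continuous_surjective (i : ℕ) :
    Continuous (levelToN X d T Sigma SigmaHat hsub hne hprime S h36 hp TpH HatH hle cuspMeetsH i) ∧
      Function.Surjective (levelToN X d T Sigma SigmaHat hsub hne hprime S h36 hp TpH HatH hle cuspMeetsH i) := by
  refine ⟨?_, ?_⟩
  · refine Continuous.subtype_mk ?_ _
    exact Continuous.subtype_mk (continuous_subtype_val.comp continuous_subtype_val) _
  · intro n
    have hn : ((n : X.DeltaTemp) : X.PiTemp) ∈ X.augGK.toMonoidHom.ker := by
      rw [ker_augGK_eq_deltaTemp]; exact (n : X.DeltaTemp).2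
    exact ⟨⟨⟨((n : X.DeltaTemp) : X.PiTemp), hn⟩, (toHat_mem_levelJhat_iff X d T i _).2 n.2⟩, rfl⟩

/-- `J_i ↠ Π^tp_{𝔾_{J_i}}`: `adm i` on the level `J_i = Δ^tp_X ∩ ι⁻¹(Ĵ_i)` of the genuine datum (`= N_i`).
([IUTchI] Prop 2.4(i) p.50) [claim: Mochizuki2012, status: disputed] -/
def piTpLevel (i : ℕ) :
    (ofSpecialFibre X d S h36 Sigma SigmaHat hsub hne hprime hp TpH HatH hle cuspMeetsH).levelTp
        (levelJhat X T i) →* (T.chart i).G :=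
  (T.adm i).toMonoidHom.comp (levelToN X d T Sigma SigmaHat hsub hne hprime S h36 hp TpH HatH hle cuspMeetsH i)

/-- `piTpLevel` is continuous. ([IUTchI] Prop 2.4(i) p.50) [claim: Mochizuki2012, status: disputed] -/
theorem piTpLevel_continuous (i : ℕ) :
    Continuous (piTpLevel X d T Sigma SigmaHat hsub hne hprime S h36 hp TpH HatH hle cuspMeetsH i) :=
  (T.adm i).continuous.comp
    (levelToN_continuous_surjective X d T Sigma SigmaHat hsub hne hprime S h36 hp TpH HatH hle cuspMeetsH i).1

/-- `piTpLevel` is surjective (`adm i` is). ([IUTchI] Prop 2.4(i) p.50) [claim: Mochizuki2012, status: disputed] -/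
theorem piTpLevel_surjective (i : ℕ) :
    Function.Surjective (piTpLevel X d T Sigma SigmaHat hsub hne hprime S h36 hp TpH HatH hle cuspMeetsH i) :=
  (T.adm_surjective i).comp
    (levelToN_continuous_surjective X d T Sigma SigmaHat hsub hne hprime S h36 hp TpH HatH hle cuspMeetsH i).2

/-- **The LEVEL DATA of the proof of Prop. 2.4 (i) at the genuine 𝔛-data, from the special-fibre tower.**
([IUTchI] Prop 2.4(i) p.50) [claim: Mochizuki2012, status: disputed] -/
def towerOfSpecialFibreTower :
    (ofSpecialFibre X d S h36 Sigma SigmaHat hsub hne hprime hp TpH HatH hle cuspMeetsH).Prop24Tower where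
  I := ℕ
  Jhat := levelJhat X T
  G := levelGraph X T Sigma SigmaHat hsub hne hprime
  πtp := piTpLevel X d T Sigma SigmaHat hsub hne hprime S h36 hp TpH HatH hle cuspMeetsH
  πtp_continuous := piTpLevel_continuous X d T Sigma SigmaHat hsub hne hprime S h36 hp TpH HatH hle cuspMeetsH
  πtp_surjective := piTpLevel_surjective X d T Sigma SigmaHat hsub hne hprime S h36 hp TpH HatH hle cuspMeetsH
  πhat i :=
    (piHatLevel X d T i).toMonoidHom.comp
      { toFun := fun z => ⟨⟨(z : X.PiHat), levelJhat_le_deltaHat X T i z.2⟩,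
          ((mem_levelJhat_iff X T).1 z.2).2⟩
        map_one' := Subtype.ext (Subtype.ext rfl)
        map_mul' := fun _ _ => Subtype.ext (Subtype.ext rfl) }
  comp i x hx := by
    change iotaGraph X T i
        (T.adm i (levelToN X d T Sigma SigmaHat hsub hne hprime S h36 hp TpH HatH hle cuspMeetsH i ⟨x, hx⟩)) =
      piHatLevel X d T i _
    rw [← piHatLevel_iotaLevel X d T i]
    rfl

/-! ### The structural sub-nodes at the genuine datum -/

/-- **`LevelsClosed`** at the genuine datum. ([IUTchI] Prop 2.4(i) p.50) [claim: Mochizuki2012, status: disputed] -/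
theorem towerOfSpecialFibreTower_levelsClosed :
    (towerOfSpecialFibreTower X d T Sigma SigmaHat hsub hne hprime S h36 hp TpH HatH hle cuspMeetsH).LevelsClosed :=
  fun i => isClosed_levelJhat X T i

/-- **`LevelsInDelta`** at the genuine datum (`Ĵ_i ⊆ Δ_X = Ker(Π̂_X → G_k)`). ([IUTchI] Prop 2.4(i) p.50) [claim: Mochizuki2012, status: disputed] -/
theorem towerOfSpecialFibreTower_levelsInDelta :
    (towerOfSpecialFibreTower X d T Sigma SigmaHat hsub hne hprime S h36 hp TpH HatH hle cuspMeetsH).LevelsInDelta := by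
  intro i z hz
  change z ∈ (augHatGK X).ker
  rw [ker_augHatGK_eq_deltaHat X d]
  exact levelJhat_le_deltaHat X T i hz

/-- **`LevelsNormal`** at the genuine datum. ([IUTchI] Prop 2.4(i) p.50) [claim: Mochizuki2012, status: disputed] -/
theorem towerOfSpecialFibreTower_levelsNormal :
    (towerOfSpecialFibreTower X d T Sigma SigmaHat hsub hne hprime S h36 hp TpH HatH hle cuspMeetsH).LevelsNormal := by
  intro i
  change ((levelJhat X T i).subgroupOf (augHatGK X).ker).Normal
  rw [ker_augHatGK_eq_deltaHat X d, levelJhat_subgroupOf]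
  exact levelHat_normal X T i

/-- **`LevelsOpen`** at the genuine datum. ([IUTchI] Prop 2.4(i) p.50) [claim: Mochizuki2012, status: disputed] -/
theorem towerOfSpecialFibreTower_levelsOpen :
    (towerOfSpecialFibreTower X d T Sigma SigmaHat hsub hne hprime S h36 hp TpH HatH hle cuspMeetsH).LevelsOpen := by
  intro i
  change IsOpen (((levelJhat X T i).subgroupOf (augHatGK X).ker : Subgroup (augHatGK X).ker) :
    Set (augHatGK X).ker)
  rw [ker_augHatGK_eq_deltaHat X d, levelJhat_subgroupOf]
  exact isOpen_levelHat X d T i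

include d in
/-- Cofinality of the `Ĵ_i ∩ K` in any `K = Δ_X` (auxiliary form of `LevelsCofinal`, stated for a subgroup
`K` propositionally equal to `Δ_X` so that it applies to `Ker(Π̂_X → G_k)`), under the COFINALITY reading of
"exhaustive" for the `N_i`. ([IUTchI] Prop 2.4(i) p.50) [claim: Mochizuki2012, status: disputed] -/
theorem levelJhat_cofinal_aux
    (hcof : ∀ U : Subgroup X.DeltaTemp, IsOpen (U : Set X.DeltaTemp) → U.Normal → U.FiniteIndex →
      ∃ i, T.N i ≤ U)
    (K : Subgroup X.PiHat) (hK : K = X.DeltaHat) (U : Subgroup K) (hU : IsOpen (U : Set K)) :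
    ∃ i, (levelJhat X T i).subgroupOf K ≤ U := by
  subst hK
  have hΔ := X.isProfiniteCompletion_deltaToHat d
  haveI : CompactSpace X.DeltaHat := hΔ.compactSpace
  haveI : TotallyDisconnectedSpace X.DeltaHat := hΔ.totallyDisconnectedSpace
  obtain ⟨W, hW⟩ := ProfiniteGrp.exist_openNormalSubgroup_sub_open_nhds_of_one hU U.one_mem
  have hWU : W.toSubgroup ≤ U := fun z hz => hW hz
  -- `ι⁻¹(W)` is open, normal, of finite index in `Δ^temp_X`
  haveI : W.toSubgroup.FiniteIndex := by
    haveI : Finite (X.DeltaHat ⧸ W.toSubgroup) :=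
      Subgroup.quotient_finite_of_isOpen _ W.toOpenSubgroup.isOpen
    exact Subgroup.finiteIndex_of_finite_quotient
  have hfi : (W.toSubgroup.comap X.deltaToHat.toMonoidHom).FiniteIndex := by
    haveI : W.toSubgroup.IsFiniteRelIndex X.deltaToHat.toMonoidHom.range :=
      Subgroup.isFiniteRelIndex_of_finiteIndex
    exact ⟨by rw [Subgroup.index_comap]; exact Subgroup.relIndex_ne_zero⟩
  haveI : W.toSubgroup.Normal := W.isNormal'
  obtain ⟨i, hi⟩ := hcof (W.toSubgroup.comap X.deltaToHat.toMonoidHom)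
    (W.toOpenSubgroup.isOpen.preimage X.deltaToHat.continuous) inferInstance hfi
  refine ⟨i, ?_⟩
  rw [levelJhat_subgroupOf]
  refine le_trans ?_ hWU
  refine Subgroup.topologicalClosure_minimal _ ?_ W.toOpenSubgroup.isClosed
  exact le_trans (Subgroup.map_mono hi) (Subgroup.map_comap_le _ _)

/-- **`LevelsCofinal`** at the genuine datum, under the COFINALITY reading of "exhaustive" for the `N_i`
(hypothesis `hcof`; L3's `N_exhaustive` is only `⋂ N_i = 1`): an open subgroup of the profinite `Δ_X` contains
an open normal one, whose preimage in `Δ^temp_X` is open normal of finite index, hence contains some `N_i`, whose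
closure is then inside. ([IUTchI] Prop 2.4(i) p.50) [claim: Mochizuki2012, status: disputed] -/
theorem towerOfSpecialFibreTower_levelsCofinal
    (hcof : ∀ U : Subgroup X.DeltaTemp, IsOpen (U : Set X.DeltaTemp) → U.Normal → U.FiniteIndex →
      ∃ i, T.N i ≤ U) :
    (towerOfSpecialFibreTower X d T Sigma SigmaHat hsub hne hprime S h36 hp TpH HatH hle cuspMeetsH).LevelsCofinal :=
  fun U hU => levelJhat_cofinal_aux X d T hcof (augHatGK X).ker (ker_augHatGK_eq_deltaHat X d) U hU

/-- **`DeltaHatClosed`** at the genuine datum (`Δ̂_X = Ker(Π̂_X → G_k) = Δ_X` is closed).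
([IUTchI] §2 p.47) [claim: Mochizuki2012, status: disputed] -/
theorem ofSpecialFibre_deltaHatClosed :
    (ofSpecialFibre X d S h36 Sigma SigmaHat hsub hne hprime hp TpH HatH hle cuspMeetsH).DeltaHatClosed := by
  change IsClosed (((augHatGK X).ker : Subgroup X.PiHat) : Set X.PiHat)
  rw [ker_augHatGK_eq_deltaHat X d]
  exact Subgroup.isClosed_topologicalClosure _

/-- **`DeltaHatDense`** at the genuine datum (`Δ_X` is the closure of `ι(Δ^temp_X)`).
([IUTchI] §2 p.47) [claim: Mochizuki2012, status: disputed] -/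
theorem ofSpecialFibre_deltaHatDense :
    (ofSpecialFibre X d S h36 Sigma SigmaHat hsub hne hprime hp TpH HatH hle cuspMeetsH).DeltaHatDense := by
  change (((augHatGK X).ker : Subgroup X.PiHat) : Set X.PiHat) ⊆
    closure (Set.range fun x : X.augGK.toMonoidHom.ker => X.toHat (x : X.PiTemp))
  rw [ker_augHatGK_eq_deltaHat X d]
  have hr : (Set.range fun x : X.augGK.toMonoidHom.ker => X.toHat (x : X.PiTemp)) =
      ((X.DeltaTemp.map X.toHat.toMonoidHom : Subgroup X.PiHat) : Set X.PiHat) := by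
    ext z
    simp only [Set.mem_range, SetLike.mem_coe, Subgroup.mem_map]
    constructor
    · rintro ⟨x, rfl⟩
      exact ⟨x, (ker_augGK_eq_deltaTemp X) ▸ x.2, rfl⟩
    · rintro ⟨x, hx, rfl⟩
      exact ⟨⟨x, (ker_augGK_eq_deltaTemp X).symm ▸ hx⟩, rfl⟩
  rw [hr, ← Subgroup.topologicalClosure_coe]
  rfl

/-- **[IUTchI] Prop. 2.4 (i) AS TYPED at the genuine 𝔛-data**, from the special-fibre tower: the structural
sub-nodes are discharged (above); what remains named is exactly the analytic content of the printed proof —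
Prop. 2.1 for every level graph `𝔾_{J_i}` (`h21`), "[Config] Rmk 1.2.2" for `Δ̂_X` (`hstf`), the `p ∉ Σ`
specialisation of pro-`Σ` abelianizations (`hspec`), the inverse-limit detection of tempered elements (`hINV`)
— and the cofinality of the `N_i` (`hcof`).  [`prop24i_of_sub`, abc-iut-w5-d119.]
[cite: Mochizuki2012, Prop 2.4(i) p.50] -/
theorem prop24i_ofSpecialFibre_of_tower
    (hcof : ∀ U : Subgroup X.DeltaTemp, IsOpen (U : Set X.DeltaTemp) → U.Normal → U.FiniteIndex →
      ∃ i, T.N i ≤ U)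
    (hstf : (ofSpecialFibre X d S h36 Sigma SigmaHat hsub hne hprime hp TpH HatH hle cuspMeetsH).StronglyTorsionFreeSigma)
    (h21 : (towerOfSpecialFibreTower X d T Sigma SigmaHat hsub hne hprime S h36 hp TpH HatH hle cuspMeetsH).Prop21Levels)
    (hspec : (towerOfSpecialFibreTower X d T Sigma SigmaHat hsub hne hprime S h36 hp TpH HatH hle cuspMeetsH).SpecializationAb)
    (hINV : (towerOfSpecialFibreTower X d T Sigma SigmaHat hsub hne hprime S h36 hp TpH HatH hle cuspMeetsH).DetectsTempered) :
    (ofSpecialFibre X d S h36 Sigma SigmaHat hsub hne hprime hp TpH HatH hle cuspMeetsH).Prop24i := by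
  haveI : T2Space X.PiHat := X.isProfiniteCompletion_toHat.t2Space
  haveI : TotallyDisconnectedSpace X.PiHat := X.isProfiniteCompletion_toHat.totallyDisconnectedSpace
  exact prop24i_of_sub (towerOfSpecialFibreTower X d T Sigma SigmaHat hsub hne hprime S h36 hp TpH HatH hle
      cuspMeetsH)
    (ofSpecialFibre_deltaHatClosed X d Sigma SigmaHat hsub hne hprime S h36 hp TpH HatH hle cuspMeetsH)
    (ofSpecialFibre_deltaHatDense X d Sigma SigmaHat hsub hne hprime S h36 hp TpH HatH hle cuspMeetsH) hstf
    (towerOfSpecialFibreTower_levelsInDelta X d T Sigma SigmaHat hsub hne hprime S h36 hp TpH HatH hle cuspMeetsH)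
    (towerOfSpecialFibreTower_levelsNormal X d T Sigma SigmaHat hsub hne hprime S h36 hp TpH HatH hle cuspMeetsH)
    (towerOfSpecialFibreTower_levelsOpen X d T Sigma SigmaHat hsub hne hprime S h36 hp TpH HatH hle cuspMeetsH)
    (towerOfSpecialFibreTower_levelsCofinal X d T Sigma SigmaHat hsub hne hprime S h36 hp TpH HatH hle
      cuspMeetsH hcof)
    h21 hspec hINV

end OfSpecialFibre

end StableCurveTemperedData

end Literature.IUT.HodgeTheaters

end
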